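import Summits.KontsevichZagierPeriods.KontsevichZagierPeriods.Theorems.TerasomaMultiplicationMultiplicationAccessibleRotationAverage
import Literature.NumberTheory.Transcendental.KZGroundingRelations

/-!
# `MultiplicationAccessible` (stmt-KontsevichZagierPeriods-12305), line `shifted-family-prime-sieve`:
the ROTATION AVERAGE in dimension `p = n + 2` — `[box, g₀ f_x] ∼ [box, f_x]`

General-`p` version of `rotationAverageThree`. With the shifted integrand
`f_x(t) = ∏_(k<p) t_k^(x+k/p−1)(1−t_k)^(s−1)` on the open box `(0,1)^p`, the geometric mean
`Z = (∏ t)^(1/p)`, the monomials `m_j = (∏_(i<j) t_i)/Z^j` and `g₀ = (∑_j m_j)/p`, the cyclic shift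
`τ^j : t ↦ (k ↦ t_(k+j))` satisfies `m_j · f_x = f_x ∘ τ^j` (`RotationGen.shift_eq`: rational-exponent
book-keeping, `((k + j) mod p)/p = k/p + j/p − [p ≤ k + j]`), so

  `[box, g₀ f_x] ∼ [box, f_x]`   (`rotationAverageGen`, registered sub-goal)

by `p` coordinate relabellings (`KZ.of_sub_of_reindex_mem_relations`), iterated integrand additivity
(`KZ.of_sub_sum_integrand_mem_relations`) and `[σ, p·(f/p)] ≡ p·[σ, f/p]`
(`KZ.IntegralRep.of_constMul_nat_sub_nsmul_mem_relations`).
References: Andrews–Askey–Roy 1999 pp. 30–31; Kontsevich–Zagier 2001 §1.2.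
-/

noncomputable section

open MeasureTheory Set Real
open scoped BigOperators
open Literature.NumberTheory.Transcendental
open Literature.NumberTheory.Transcendental.KZ

namespace Summit.KontsevichZagierPeriods.TerasomaMultiplication.MultiplicationAccessible

namespace RotationGen

/-- `Z^j = ((∏ t)^(1/p))^j = ∏_k t_k^(j/p)` for positive `t`. [folklore] -/
theorem geomMean_pow_eq {m : ℕ} (p : ℝ) (j : ℕ) (t : Fin m → ℝ) (ht : ∀ k, 0 < t k) :
    ((∏ k, t k) ^ (1 / p)) ^ j = ∏ k, (t k) ^ ((j:ℝ) / p) := by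
  rw [← Real.rpow_natCast, ← Real.rpow_mul (Finset.prod_nonneg fun k _ => (ht k).le),
    ← Real.finsetProd_rpow _ _ (fun k _ => (ht k).le)]
  congr 1
  ring

/-- **`m_j · f_x = f_x ∘ τ^j`** on the positive orthant: with `Z = (∏ t)^(1/p)`,
`(∏_(i<j) t_i)/Z^j · ∏_k t_k^(x+k/p−1)(1−t_k)^(s−1) = ∏_k t_(k+j)^(x+k/p−1)(1−t_(k+j))^(s−1)`.
The exponent of `t_(k+j)` on the left is `x + ((k+j) mod p)/p − 1 − j/p + [p ≤ k+j] = x + k/p − 1`.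
[cite: AndrewsAskeyRoy1999, Thm 1.5.2] -/
theorem shift_eq (n : ℕ) (x s : ℝ) (j : Fin (n + 2)) (t : Fin (n + 2) → ℝ) (ht : ∀ k, 0 < t k) :
    (∏ i ∈ Finset.univ.filter (fun i : Fin (n + 2) => i < j), t i) /
        ((∏ k, t k) ^ (1 / ((n:ℝ) + 2))) ^ (j:ℕ) *
      ∏ k : Fin (n + 2), (t k) ^ (x + ((k:ℕ):ℝ) / ((n:ℝ) + 2) - 1) * (1 - t k) ^ (s - 1) =
    ∏ k : Fin (n + 2), (t (k + j)) ^ (x + ((k:ℕ):ℝ) / ((n:ℝ) + 2) - 1) *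
      (1 - t (k + j)) ^ (s - 1) := by
  have hp0 : (0:ℝ) < (n:ℝ) + 2 := by positivity
  rw [Finset.prod_filter, geomMean_pow_eq _ _ t ht, ← Finset.prod_div_distrib,
    ← Finset.prod_mul_distrib]
  symm
  refine Fintype.prod_equiv (Equiv.addRight j) _ _ fun k => ?_
  simp only [Equiv.coe_addRight]
  have hτ := ht (k + j)
  have hτj : t (k + j) ^ (((j:ℕ):ℝ) / ((n:ℝ) + 2)) ≠ 0 := (Real.rpow_pos_of_pos hτ _).ne'
  rcases Nat.lt_or_ge (k.val + j.val) (n + 2) with hlt | hge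
  · have hmv : ((k + j : Fin (n + 2)) : ℕ) = (k:ℕ) + (j:ℕ) := Fin.val_add_eq_of_add_lt hlt
    have hmj : ¬ k + j < j := by
      rw [Fin.lt_def, hmv]
      omega
    rw [if_neg hmj, hmv, Nat.cast_add]
    have e : t (k + j) ^ (x + (((k:ℕ):ℝ) + ((j:ℕ):ℝ)) / ((n:ℝ) + 2) - 1) =
        t (k + j) ^ (x + ((k:ℕ):ℝ) / ((n:ℝ) + 2) - 1) * t (k + j) ^ (((j:ℕ):ℝ) / ((n:ℝ) + 2)) := by
      rw [← Real.rpow_add hτ]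
      congr 1
      ring
    rw [e]
    field_simp
  · have hmv : ((k + j : Fin (n + 2)) : ℕ) = (k:ℕ) + (j:ℕ) - (n + 2) := by
      rw [Fin.val_add_eq_ite, if_pos hge]
    have hmj : k + j < j := by
      rw [Fin.lt_def, hmv]
      omega
    rw [if_pos hmj, hmv, Nat.cast_sub hge, Nat.cast_add]
    have e : t (k + j) * t (k + j) ^ (x + (((k:ℕ):ℝ) + ((j:ℕ):ℝ) - ((n + 2 : ℕ):ℝ)) / ((n:ℝ) + 2) - 1) =
        t (k + j) ^ (x + ((k:ℕ):ℝ) / ((n:ℝ) + 2) - 1) * t (k + j) ^ (((j:ℕ):ℝ) / ((n:ℝ) + 2)) := by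
      rw [show ∀ E : ℝ, t (k + j) * t (k + j) ^ E = t (k + j) ^ (1 + E) from fun E => by
        rw [Real.rpow_add hτ, Real.rpow_one], ← Real.rpow_add hτ]
      congr 1
      push_cast
      field_simp
      ring
    rw [div_mul_eq_mul_div, ← mul_assoc, e]
    field_simp

/-- The box `(0,1)^m` is stable under relabelling by a permutation of the coordinates. [folklore] -/
theorem reindex_domain_box {m : ℕ} (r : IntegralRep m)
    (hr : r.domain = {t | ∀ i, t i ∈ Set.Ioo (0:ℝ) 1}) (e : Fin m ≃ Fin m) :
    (r.reindex e).domain = {t | ∀ i, t i ∈ Set.Ioo (0:ℝ) 1} := by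
  ext w
  simp only [IntegralRep.reindex_domain, hr, mem_setOf_eq]
  exact ⟨fun h i => by simpa using h (e.symm i), fun h i => h (e i)⟩

end RotationGen

/-- **The rotation average in dimension `p = n + 2`** (registered sub-goal `rotationAverageGen` of
the line `shifted-family-prime-sieve`): every box representation of the shifted integrand `f_x` is
equivalent to every box representation of `g₀ f_x`, `g₀ = (∑_j m_j)/p`, `m_j = (∏_(i<j) t_i)/Z^j`,
`Z = (∏ t)^(1/p)` — since `g₀ f_x = (∑_j f_x ∘ τ^j)/p` for the cyclic shifts `τ^j`: `p` changes of
variables (the relabellings, `KZ.of_sub_of_reindex_mem_relations`), iterated integrand additivity, and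
`[σ, f] ≡ p·[σ, f/p]`. [cite: KontsevichZagier2001, §1.2 rules (1), (2)] -/
theorem rotationAverageGen : ∀ (n : ℕ) (x s : ℚ), 0 < x → 0 < s → ∀ (G : (Fin (n + 2) → ℝ) → ℝ), (∀ t : Fin (n + 2) → ℝ, G t = (∑ j : Fin (n + 2), (∏ i ∈ Finset.univ.filter (fun i : Fin (n + 2) => i < j), t i) /
        ((∏ k, t k) ^ (1 / ((n:ℝ) + 2))) ^ (j:ℕ)) / ((n:ℝ) + 2) *
      ∏ k : Fin (n + 2), (t k) ^ ((x:ℝ) + ((k:ℕ):ℝ) / ((n:ℝ) + 2) - 1) * (1 - t k) ^ ((s:ℝ) - 1)) →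
    ∀ (r r₀ : KZ.IntegralRep (n + 2)), r.domain = {t : Fin (n + 2) → ℝ | ∀ k, t k ∈ Set.Ioo (0:ℝ) 1} →
    Set.EqOn r.integrand (fun t => ∏ k : Fin (n + 2), (t k) ^ ((x:ℝ) + ((k:ℕ):ℝ) / ((n:ℝ) + 2) - 1) * (1 - t k) ^ ((s:ℝ) - 1)) r.domain →
    r₀.domain = {t : Fin (n + 2) → ℝ | ∀ k, t k ∈ Set.Ioo (0:ℝ) 1} → Set.EqOn r₀.integrand G r₀.domain → KZ.Equivalent r r₀ := by
  intro n x s _ _ G hG r r₀ hr hri hr₀ hr₀i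
  have hp0 : (0:ℝ) < (n:ℝ) + 2 := by positivity
  have hpalg : IsAlgebraic ℚ (((n:ℝ) + 2)⁻¹) := by
    have := isAlgebraic_nat (R := ℚ) (A := ℝ) (n + 2)
    push_cast at this
    exact this.inv
  -- `[box, f/p]` and its `p` cyclic relabellings
  set Rp := r.constMul (((n:ℝ) + 2)⁻¹) hpalg with hRp
  have hRpd : Rp.domain = {t | ∀ i, t i ∈ Set.Ioo (0:ℝ) 1} := by
    rw [hRp, IntegralRep.domain_constMul, hr]
  set R : Fin (n + 2) → IntegralRep (n + 2) := fun j => Rp.reindex (Equiv.addRight j) with hR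
  have hRd : ∀ j, (R j).domain = {t | ∀ i, t i ∈ Set.Ioo (0:ℝ) 1} := fun j =>
    RotationGen.reindex_domain_box Rp hRpd _
  -- (1) iterated additivity: `g₀ f = ∑_j (f ∘ τ^j)/p`
  have h1 : of r₀ - ∑ j, of (R j) ∈ relations := by
    refine of_sub_sum_integrand_mem_relations Finset.univ R r₀ (fun j _ => by rw [hRd, hr₀])
      fun t ht => ?_
    rw [hr₀i ht, hG t]
    rw [hr₀] at ht
    simp only [hR, hRp, IntegralRep.reindex_integrand, IntegralRep.integrand_constMul,
      Equiv.coe_addRight]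
    rw [Finset.sum_div, Finset.sum_mul]
    refine Finset.sum_congr rfl fun j _ => ?_
    have htj : (fun i => t (i + j)) ∈ r.domain := by
      rw [hr]
      exact fun i => ht _
    rw [hri htj]
    beta_reduce
    rw [← RotationGen.shift_eq n x s j t (fun k => (ht k).1)]
    ring
  -- (2) the relabellings are changes of variables
  have h2 : ∑ j : Fin (n + 2), (of Rp - of (R j)) ∈ relations :=
    sum_mem fun j _ => of_sub_of_reindex_mem_relations Rp _
  -- (3) `[box, f] ≡ p • [box, f/p]`
  have h3 : of (Rp.constMul ((n + 2 : ℕ) : ℝ) (isAlgebraic_nat (n + 2))) - (n + 2) • of Rp ∈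
      relations :=
    IntegralRep.of_constMul_nat_sub_nsmul_mem_relations Rp (n + 2)
  have h4 : of r - of (Rp.constMul ((n + 2 : ℕ) : ℝ) (isAlgebraic_nat (n + 2))) ∈ relations := by
    refine of_sub_of_mem_relations_of_eqOn (by rw [IntegralRep.domain_constMul, hRpd, hr])
      fun t _ => ?_
    simp only [hRp, IntegralRep.integrand_constMul]
    push_cast
    rw [← mul_assoc, mul_inv_cancel₀ hp0.ne', one_mul]
  have key : of r - of r₀ = (of r - of (Rp.constMul ((n + 2 : ℕ) : ℝ) (isAlgebraic_nat (n + 2)))) +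
      (of (Rp.constMul ((n + 2 : ℕ) : ℝ) (isAlgebraic_nat (n + 2))) - (n + 2) • of Rp) +
      ∑ j : Fin (n + 2), (of Rp - of (R j)) - (of r₀ - ∑ j, of (R j)) := by
    rw [Finset.sum_sub_distrib, Finset.sum_const, Finset.card_univ, Fintype.card_fin]
    abel
  rw [Equivalent, key]
  exact relations.sub_mem (relations.add_mem (relations.add_mem h4 h3) h2) h1

end Summit.KontsevichZagierPeriods.TerasomaMultiplication.MultiplicationAccessible

end
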